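import Summits.AnomalousDissipation.AnomalousDissipation.Theorems.SolenoidalFractalHomogenisationLagrangianCarrierConstructionFlowsL
import HarnessLib

/-!
# K3L `LagrangianCarrierConstruction` (stmt-AnomalousDissipation-24913), line `birth`, stub `stub_regularL`: the abstract displacements of a
# qualitatively regular Lagrangian carrier ARE the evolution maps of the lifted partial sums (helper; `--supports stmt-AnomalousDissipation-24913`)

Summits-side helper file (everything proved; no definitions, no named facts). First brick towards `stub_regularL` (skeleton r23 v6), whose
hypotheses describe an ABSTRACT Lagrangian lattice carrier `E` through `IsLagrangian` and the eleven qualitative clauses of `LevelRegular`: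
under (L1) joint continuity, (L3a) smoothness and (L3b) (first-order) derivative bounds of the level fields, the lifted partial sum
`B_m(t, z) = (b 1 + ⋯ + b m)(t, proj z)` satisfies the Cauchy–Lipschitz hypotheses on the whole time axis
(`isUniformlyLipschitzOn_partialSum_proj`), and then the integral form `IsFlow m` of the flow equation together with (F1a) (continuity of
the displacement in time) IDENTIFIES the displacement: `repr x + disp m t s x = φ_{B_m}(s → t)(repr x)` (`repr_add_disp_eq_evolutionMap`, ODE
uniqueness `IsUniformlyLipschitzOn.eq_evolutionMap`). This is what lets the tower calculus of `…TowerDet`, `…TowerPeriodic`, … be applied to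
the abstract `E` of `stub_regularL`. Infrastructure for route-1's rung leaf F-D1.A0 (a frontier FORMAL rung); NOT a proof of anomalous dissipation.
-/

set_option linter.dupNamespace false

noncomputable section

namespace Summit.AnomalousDissipation.AnomalousDissipation.Theorems.SolenoidalFractalHomogenisation.LagrangianCarrierConstruction

open Set Function Filter Topology MeasureTheory
open scoped NNReal ContDiff
open Literature.Analysis Literature.Analysis.ODE Literature.Analysis.FunctionSpaces Literature.Analysis.FunctionSpaces.Torus
open Literature.Analysis.FluidPDE Literature.Analysis.FluidPDE.LatticeShear

variable {k : ℕ}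

/-- A smooth function on `ℝᵈ` with bounded first derivative (stated through `iteratedFDeriv ℝ 1`) is Lipschitz. [folklore] -/
theorem lipschitzWith_of_iteratedFDeriv_one_le {f : EuclideanSpace ℝ (Fin 3) → EuclideanSpace ℝ (Fin 3)} (hf : ContDiff ℝ ∞ f) {C : ℝ}
    (hC : ∀ y, ‖iteratedFDeriv ℝ 1 f y‖ ≤ C) : LipschitzWith (Real.toNNReal C) f := by
  refine lipschitzWith_of_nnnorm_fderiv_le (hf.differentiable (by simp)) fun y => ?_
  have h : ‖fderiv ℝ f y‖ ≤ C := by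
    rw [← norm_iteratedFDeriv_zero (𝕜 := ℝ) (f := fderiv ℝ f) (x := y), norm_iteratedFDeriv_fderiv]
    exact hC y
  rw [← NNReal.coe_le_coe, coe_nnnorm, Real.coe_toNNReal']
  exact h.trans (le_max_left _ _)

/-- **The lifted partial sum of the level fields satisfies the Cauchy–Lipschitz hypotheses** (continuous in time, Lipschitz in space
uniformly in time) under (L1), (L3a), (L3b). [folklore] -/
theorem isUniformlyLipschitzOn_partialSum_proj (E : LagrangianLatticeCarrier k)
    (h1 : ∀ m, Continuous (uncurry (E.b (m + 1)))) (h3a : ∀ m t, IsSmooth (E.b (m + 1) t))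
    (h3b : ∀ m (n : ℕ), ∃ C : ℝ, ∀ t y, ‖iteratedFDeriv ℝ n (Torus.lift (E.b (m + 1) t)) y‖ ≤ C) (m : ℕ) :
    IsUniformlyLipschitzOn (fun t (z : EuclideanSpace ℝ (Fin 3)) => E.partialSum m t (proj z)) univ := by
  choose C hC using fun i => h3b i 1
  refine IsUniformlyLipschitzOn.of_lipschitzWith (K := ∑ i ∈ Finset.range m, Real.toNNReal (C i)) (fun z => ?_) fun t _ => ?_
  · refine Continuous.continuousOn ?_
    unfold LagrangianLatticeCarrier.partialSum
    exact continuous_finsetSum _ fun i _ => (h1 i).comp (continuous_id.prodMk continuous_const)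
  · have hterm : ∀ i, LipschitzWith (Real.toNNReal (C i)) fun z : EuclideanSpace ℝ (Fin 3) => E.b (i + 1) t (proj z) := fun i => by
      have h := lipschitzWith_of_iteratedFDeriv_one_le (h3a i t) (hC i t)
      exact h
    have hsum : ∀ m', LipschitzWith (∑ i ∈ Finset.range m', Real.toNNReal (C i))
        fun z : EuclideanSpace ℝ (Fin 3) => ∑ i ∈ Finset.range m', E.b (i + 1) t (proj z) := by
      intro m'
      induction m' with
      | zero => simp
      | succ n ih =>
        simp only [Finset.sum_range_succ]
        exact ih.add (hterm n)
    exact hsum m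

/-- **Identification of the displacements.** Under `IsFlow m`, (L1), (L3a), (L3b) and (F1a), the lifted Lagrangian curve
`r ↦ repr x + disp m r s x` is the integral curve of the lifted partial sum through `repr x` at time `s`:
`repr x + disp m t s x = φ(s → t)(repr x)`. [cite: ArmstrongVicol2025, §2.2 (PDF p. 18: the flows X_m of b_{≤m})] -/
theorem repr_add_disp_eq_evolutionMap (E : LagrangianLatticeCarrier k) (m : ℕ) (hflow : E.IsFlow m)
    (h1 : ∀ m, Continuous (uncurry (E.b (m + 1)))) (h3a : ∀ m t, IsSmooth (E.b (m + 1) t))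
    (h3b : ∀ m (n : ℕ), ∃ C : ℝ, ∀ t y, ‖iteratedFDeriv ℝ n (Torus.lift (E.b (m + 1) t)) y‖ ≤ C)
    (hF1a : ∀ m s, Continuous fun p : ℝ × UnitAddTorus (Fin 3) => E.disp m p.1 s p.2) (t s : ℝ) (x : UnitAddTorus (Fin 3)) :
    repr x + E.disp m t s x = evolutionMap (fun t (z : EuclideanSpace ℝ (Fin 3)) => E.partialSum m t (proj z)) s t (repr x) := by
  have hB := isUniformlyLipschitzOn_partialSum_proj E h1 h3a h3b m
  have hBc : Continuous (uncurry fun t (z : EuclideanSpace ℝ (Fin 3)) => E.partialSum m t (proj z)) := by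
    have h := hB.continuousOn_uncurry convex_univ
    rwa [univ_prod_univ, continuousOn_univ] at h
  -- the lifted curve, its continuity and its flow equation
  have hγc : Continuous fun r => repr x + E.disp m r s x :=
    continuous_const.add ((hF1a m s).comp (continuous_id.prodMk continuous_const))
  have hX : ∀ r, E.X m r s x = proj (repr x + E.disp m r s x) := fun r => by
    unfold LagrangianLatticeCarrier.X
    rw [proj_add, proj_repr]
  have hg : Continuous fun r => E.partialSum m r (E.X m r s x) := by
    have e : (fun r => E.partialSum m r (E.X m r s x)) =
        (uncurry fun t (z : EuclideanSpace ℝ (Fin 3)) => E.partialSum m t (proj z)) ∘ fun r => (r, repr x + E.disp m r s x) := by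
      funext r; simp only [comp_apply, uncurry, hX]
    rw [e]
    exact hBc.comp (continuous_id.prodMk hγc)
  have hγ : ∀ r, HasDerivAt (fun r => repr x + E.disp m r s x) (E.partialSum m r (proj (repr x + E.disp m r s x))) r := by
    intro r
    have e : (fun r => repr x + E.disp m r s x) = fun r => repr x + ∫ r' in s..r, E.partialSum m r' (E.X m r' s x) :=
      funext fun r => by rw [hflow r s x]
    rw [e, ← hX]
    exact (intervalIntegral.integral_hasDerivAt_right (hg.intervalIntegrable _ _) (hg.stronglyMeasurableAtFilter _ _)
      hg.continuousAt).const_add _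
  have h := hB.eq_evolutionMap convex_univ (mem_univ s) (γ := fun r => repr x + E.disp m r s x)
    (fun r _ => (hγ r).hasDerivWithinAt) (mem_univ t)
  have h0 : E.disp m s s x = 0 := by rw [hflow s s x, intervalIntegral.integral_same]
  simpa [h0] using h

end Summit.AnomalousDissipation.AnomalousDissipation.Theorems.SolenoidalFractalHomogenisation.LagrangianCarrierConstruction

end
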